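import Mathlib
import HarnessLib
import Summits.ValiantsHypothesis.ValiantsHypothesis.Theorems.LacunarySymmetroidMatrixDescartesProductPlusOneSeparatingWeight
import Summits.ValiantsHypothesis.ValiantsHypothesis.Theorems.LacunarySymmetroidMatrixDescartesProductPlusOneEulerSharpK
import Summits.ValiantsHypothesis.ValiantsHypothesis.Theorems.LacunarySymmetroidMatrixDescartesProductPlusOneLetterVariance

/-!
# ValiantsHypothesis / LacunarySymmetroid — crux `MatrixDescartes` (stmt-ValiantsHypothesis-18050, V1),
# LINE (A) «product_plus_one»: the MEAN-PIVOT LAW (every format `(m, K)`, every coupling) and the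
# MEAN-ORDERED SECTOR of upper-signed companies at the bottom coupling (EVERY `K`)

Companion of ✓ `…ProductPlusOneSeparatingWeight` (separating-weight law: at a zero `z` of `E = X·P′ − C ν·P` a single weight `λ`
with `W_j(z) < λ·f_j(z)·(θf_j(z) − c_j f_j(z))` for all rows makes the zero a down-crossing).  With a UNIFORM shift `c`
(`ν = m·c`; for the line's `eulerNumerator d a l₀` this is `c = d l₀`, ✓ `eulerNumerator_eq_general`) and the shifted operator
`θ_c = θ − c`, every row satisfies (`sepWeight_meanPivot_row_identity`)

  `W(f) − μ·f·θ_c f = f·(θ_c² f − μ·θ_c f) − (θ_c f)²`,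

so a row is separated by the weight `μ` as soon as `f(z)·(θ_c²f(z) − μ·θ_c f(z)) ≤ 0` and `θ_c f(z) ≠ 0` — i.e. (when `f·θ_c f ≠ 0`)
as soon as its TILTED GAP-MEAN `μ_f(z) = θ_c²f(z)/θ_c f(z)` is on the correct side of the pivot: `μ_f ≤ μ` for rows with
`f·θ_c f > 0` («risers»), `μ_f ≥ μ` for rows with `f·θ_c f < 0` («pullers»).  For a fewnomial row `f = Σ_l a_l X^{d_l}`:
`θ_c f = Σ_l (d_l − c) a_l X^{d_l}`, `θ_c² f = Σ_l (d_l − c)² a_l X^{d_l}` (`sepWeight_eval_shiftedTheta{,_sq}`); at the bottom coupling of an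
UPPER-SIGNED row (`a_{l₀} > 0 > a_l` for `l ≠ l₀`, `d l₀ < d l`) `μ_f(x)` is the mean of the gaps `d_l − d_{l₀}` under the weights
`(d_l − d_{l₀})|a_l| x^{d_l}` — for `K = 3` a decreasing function of the middle/top ratio `|b|/|c|`, recovering the ratio-ordered sector
of ✓ `sepWeight_ratioOrdered_incoherent`.

* `sepWeight_meanPivot_row_identity`, `sepWeight_meanPivot_row_neg` — the row identity / criterion (any row, any shift);
* ★★ `sepWeight_meanPivot_pos_roots_le` — every format, uniform shift: a pivot `μ(z)` at every positive zero ⇒ `Z₊(E) ≤ B + (B + 1)`;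
* `sepWeight_eval_shiftedTheta`, `sepWeight_eval_shiftedTheta_sq` — fewnomial evaluations (with ✓ `eval_fewnomial`);
* ★★ `sepWeight_meanPivot_eulerNumerator_le` — LINE CURRENCY, every `(m, K)`, every support, every coupling `l₀`: if at every positive
  zero of `eulerNumerator d a l₀` (unfolded) off the poles some pivot `μ` has `f_j(z)·(B⁽²⁾_j(z) − μ·B_j(z)) ≤ 0` and `B_j(z) ≠ 0` for all
  rows (`B_j = Σ_l (d_l − d_{l₀}) a_{jl} z^{d_l}` the line's stripped letter row, `B⁽²⁾_j = Σ_l (d_l − d_{l₀})² a_{jl} z^{d_l}`), then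
  `Z₊(eulerNumerator d a l₀) ≤ B + (B + 1)` for any bound `Z₊(∏ fewnomial) ≤ B`;
* ★★★ `sepWeight_meanOrdered_upperSigned` — THE MEAN-ORDERED SECTOR, EVERY `K`: bottom coupling (`d l₀ < d l` for `l ≠ l₀`), every
  row upper-signed against the coupled letter (`a_{j l₀} > 0`, `a_{jl} < 0` otherwise — the every-`K` «pullers»: the bottom-coupling
  twin left open by ✓ `eulerBoundPoly_lowerSignedK` / `eulerBoundPoly_upperSignedK`); if at every `x > 0` the tilted gap-mean of every
  SWITCHED row (`f_j(x) < 0`) is at most that of every UNSWITCHED row (`f_i(x) > 0`) — division-free: `B⁽²⁾_j·B_i ≤ B⁽²⁾_i·B_j` —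
  then `Z₊(eulerNumerator d a l₀) ≤ B + (B + 1)` for any bound `Z₊(∏ f_j) ≤ B` (`B = m` by Descartes for these one-change rows).
  Instances: all rows with proportional tails `(a_{jl})_{l ≠ l₀} ∈ ℝ₊·(t_l)`; for `K = 3`, `|b|/|c|` non-increasing along the zeros.

HONEST FRAMING: sector/helper theorems for the research stubs `stub_oneChangeFloorK3` (K = 3) and `stub_polyLaw` / `EulerBoundPoly`
(every K); NOT those stubs, not `MatrixDescartes`; `VP ≠ VNP` is NOT proved.  No definitions, no named facts, no sorry.
-/

set_option linter.dupNamespace false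

namespace Summit.ValiantsHypothesis.ValiantsHypothesis.Theorems.LacunarySymmetroidMatrixDescartes

namespace ProductPlusOne

open Polynomial Finset
open scoped BigOperators

/-! ### §1 The mean-pivot row criterion (any row, any shift) -/

/-- **Row identity** (values at a point; `F = f(z)`, `T₁ = θf(z)`, `T₂ = θ²f(z)`, shift `c`, pivot `μ`):
`(F·T₂ − T₁²) − μ·F·(T₁ − cF) = F·((T₂ − 2cT₁ + c²F) − μ(T₁ − cF)) − (T₁ − cF)²`. [this file's lemma] -/
theorem sepWeight_meanPivot_row_identity (F T₁ T₂ c μ : ℝ) :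
    (F * T₂ - T₁ ^ 2) - μ * (F * (T₁ - c * F))
      = F * ((T₂ - 2 * c * T₁ + c ^ 2 * F) - μ * (T₁ - c * F)) - (T₁ - c * F) ^ 2 := by
  ring

/-- **Row criterion**: `F·(θ_c²f − μ θ_c f) ≤ 0` and `θ_c f ≠ 0` at the point ⟹ `W(f) < μ·F·θ_c f` there. [this file's lemma] -/
theorem sepWeight_meanPivot_row_neg {F T₁ T₂ c μ : ℝ}
    (hle : F * ((T₂ - 2 * c * T₁ + c ^ 2 * F) - μ * (T₁ - c * F)) ≤ 0) (hne : T₁ - c * F ≠ 0) :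
    F * T₂ - T₁ ^ 2 < μ * (F * (T₁ - c * F)) := by
  have h := sepWeight_meanPivot_row_identity F T₁ T₂ c μ
  have hsq : 0 < (T₁ - c * F) ^ 2 := by positivity
  linarith

/-- ★★ **THE MEAN-PIVOT LAW** (every format, uniform shift `c`, level `ν = m·c`, any rows): if at every positive zero `z` of
`E = X·P′ − C(m c)·P` off the poles SOME pivot `μ` satisfies, for every row, `f_j(z)·(θ_c²f_j(z) − μ·θ_c f_j(z)) ≤ 0` and
`θ_c f_j(z) ≠ 0` (`θ_c f = θf − c f`, `θ_c² f = θ²f − 2c·θf + c²·f`), then `Z₊(E) ≤ B + (B + 1)` for any bound `Z₊(P) ≤ B`.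
[this file's theorem] -/
theorem sepWeight_meanPivot_pos_roots_le {m : ℕ} (f : Fin m → ℝ[X]) (hP0 : (∏ j, f j) ≠ 0) (c : ℝ) (B : ℕ)
    (hZ : ((∏ j, f j).roots.toFinset.filter (fun t => 0 < t)).card ≤ B)
    (hpiv : ∀ z : ℝ, 0 < z → (∀ i, (f i).eval z ≠ 0) → (X * derivative (∏ j, f j) - C ((m : ℝ) * c) * ∏ j, f j).eval z = 0 →
      ∃ μ : ℝ, ∀ j, (f j).eval z * (((X * derivative (X * derivative (f j))).eval z - 2 * c * (X * derivative (f j)).eval z + c ^ 2 * (f j).eval z) - μ * ((X * derivative (f j)).eval z - c * (f j).eval z)) ≤ 0 ∧ (X * derivative (f j)).eval z - c * (f j).eval z ≠ 0) :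
    ((X * derivative (∏ j, f j) - C ((m : ℝ) * c) * ∏ j, f j).roots.toFinset.filter (fun t => 0 < t)).card ≤ B + (B + 1) := by
  refine sepWeight_euler_pos_roots_le f hP0 ((m : ℝ) * c) B hZ (fun z hz hfz hEz => ?_)
  obtain ⟨μ, hrow⟩ := hpiv z hz hfz hEz
  refine ⟨μ, fun _ => c, by simp, fun j => ?_⟩
  have h := sepWeight_meanPivot_row_neg (hrow j).1 (hrow j).2
  simpa only [eval_sub, eval_mul, eval_pow] using h

/-! ### §2 Fewnomial rows: the shifted `θ` evaluations -/

/-- `θ_c f(z) = Σ_l (d_l − c)·a_l·z^{d_l}` for a fewnomial row. [folklore] -/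
theorem sepWeight_eval_shiftedTheta {K : ℕ} (d : Fin K → ℕ) (b : Fin K → ℝ) (c z : ℝ) :
    (X * derivative (∑ l, C (b l) * X ^ (d l) : ℝ[X])).eval z - c * (∑ l, C (b l) * X ^ (d l) : ℝ[X]).eval z
      = ∑ l, ((d l : ℝ) - c) * b l * z ^ (d l) := by
  rw [theta_fewnomial, eval_finsetSum, eval_finsetSum, Finset.mul_sum, ← Finset.sum_sub_distrib]
  refine Finset.sum_congr rfl (fun l _ => ?_)
  simp only [eval_mul, eval_C, eval_pow, eval_X]
  ring

/-- `θ_c² f(z) = Σ_l (d_l − c)²·a_l·z^{d_l}` for a fewnomial row. [folklore] -/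
theorem sepWeight_eval_shiftedTheta_sq {K : ℕ} (d : Fin K → ℕ) (b : Fin K → ℝ) (c z : ℝ) :
    (X * derivative (X * derivative (∑ l, C (b l) * X ^ (d l) : ℝ[X]))).eval z
        - 2 * c * (X * derivative (∑ l, C (b l) * X ^ (d l) : ℝ[X])).eval z
        + c ^ 2 * (∑ l, C (b l) * X ^ (d l) : ℝ[X]).eval z
      = ∑ l, ((d l : ℝ) - c) ^ 2 * b l * z ^ (d l) := by
  rw [theta_fewnomial, theta_fewnomial, eval_finsetSum, eval_finsetSum, eval_finsetSum, Finset.mul_sum, Finset.mul_sum,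
    ← Finset.sum_sub_distrib, ← Finset.sum_add_distrib]
  refine Finset.sum_congr rfl (fun l _ => ?_)
  simp only [eval_mul, eval_C, eval_pow, eval_X]
  ring

/-! ### §3 Line currency: the mean-pivot law for `eulerNumerator d a l₀`, every `(m, K)`, every coupling -/

/-- ★★ **MEAN-PIVOT LAW IN LINE CURRENCY** (every format `(m, K)`, every support `d`, every coupling `l₀`; the line's
`eulerNumerator d a l₀` unfolded def-free as in ✓ `eulerNumerator_roots_Icc_le_budget`): with the stripped letter rows
`B_j(z) = Σ_l (d_l − d_{l₀}) a_{jl} z^{d_l}` and `B⁽²⁾_j(z) = Σ_l (d_l − d_{l₀})² a_{jl} z^{d_l}`, if at every positive zero `z` off the poles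
some pivot `μ` has `f_j(z)·(B⁽²⁾_j(z) − μ B_j(z)) ≤ 0` and `B_j(z) ≠ 0` for all rows, then `Z₊(eulerNumerator) ≤ B + (B + 1)` for any
bound `Z₊(∏_j f_j) ≤ B`. [this file's theorem] -/
theorem sepWeight_meanPivot_eulerNumerator_le {m K : ℕ} (d : Fin K → ℕ) (a : Fin m → Fin K → ℝ) (l₀ : Fin K)
    (hP0 : (∏ j, ∑ l, C (a j l) * X ^ (d l) : ℝ[X]) ≠ 0) (B : ℕ) (hZ : ((∏ j, ∑ l, C (a j l) * X ^ (d l) : ℝ[X]).roots.toFinset.filter (fun t => 0 < t)).card ≤ B)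
    (hpiv : ∀ z : ℝ, 0 < z → (∀ j, (∑ l, a j l * z ^ (d l)) ≠ 0) → (∑ j, (∑ l, C (a j l * ((d l : ℝ) - d l₀)) * X ^ (d l)) * ∏ i ∈ Finset.univ.erase j, (∑ l, C (a i l) * X ^ (d l)) : ℝ[X]).eval z = 0 →
      ∃ μ : ℝ, ∀ j, (∑ l, a j l * z ^ (d l)) * ((∑ l, ((d l : ℝ) - d l₀) ^ 2 * a j l * z ^ (d l)) - μ * (∑ l, ((d l : ℝ) - d l₀) * a j l * z ^ (d l))) ≤ 0 ∧ (∑ l, ((d l : ℝ) - d l₀) * a j l * z ^ (d l)) ≠ 0) :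
    ((∑ j, (∑ l, C (a j l * ((d l : ℝ) - d l₀)) * X ^ (d l)) * ∏ i ∈ Finset.univ.erase j, (∑ l, C (a i l) * X ^ (d l)) : ℝ[X]).roots.toFinset.filter (fun t => 0 < t)).card ≤ B + (B + 1) := by
  rw [eulerNumerator_eq_general]
  refine sepWeight_meanPivot_pos_roots_le (fun j => (∑ l, C (a j l) * X ^ (d l) : ℝ[X])) hP0 (d l₀ : ℝ) B hZ ?_
  intro z hz hfz hEz
  have hg : ∀ j, (∑ l, a j l * z ^ (d l)) ≠ 0 := by
    intro j
    have h := hfz j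
    simp only [eval_fewnomial] at h
    exact h
  have hEz' : (∑ j, (∑ l, C (a j l * ((d l : ℝ) - d l₀)) * X ^ (d l)) * ∏ i ∈ Finset.univ.erase j, (∑ l, C (a i l) * X ^ (d l)) : ℝ[X]).eval z = 0 := by
    rw [eulerNumerator_eq_general]
    exact hEz
  obtain ⟨μ, hrow⟩ := hpiv z hz hg hEz'
  refine ⟨μ, fun j => ?_⟩
  rw [sepWeight_eval_shiftedTheta_sq, sepWeight_eval_shiftedTheta, eval_fewnomial]
  exact hrow j

/-! ### §4 The mean-ordered sector of upper-signed companies at the bottom coupling, every `K` -/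

/-- the stripped letter row of an upper-signed row at the bottom coupling is NEGATIVE on `(0,∞)`:
`B_j(z) = Σ_l (d_l − d_{l₀}) a_{jl} z^{d_l} < 0`. [this file's lemma] -/
theorem sepWeight_strippedRow_neg {m K : ℕ} (d : Fin K → ℕ) (a : Fin m → Fin K → ℝ) (l₀ : Fin K)
    (hd : ∀ l, l ≠ l₀ → d l₀ < d l) (hK : ∃ l : Fin K, l ≠ l₀)
    (hup : ∀ j, 0 < a j l₀ ∧ ∀ l, l ≠ l₀ → a j l < 0) (j : Fin m) {z : ℝ} (hz : 0 < z) :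
    (∑ l, ((d l : ℝ) - d l₀) * a j l * z ^ (d l)) < 0 := by
  classical
  obtain ⟨l₁, hl₁⟩ := hK
  have hterm : ∀ l ∈ Finset.univ.erase l₁, ((d l : ℝ) - d l₀) * a j l * z ^ (d l) ≤ 0 := by
    intro l _
    by_cases hl : l = l₀
    · subst hl; simp
    · have h1 : 0 < (d l : ℝ) - d l₀ := sub_pos.mpr (by exact_mod_cast hd l hl)
      exact (mul_neg_of_neg_of_pos (mul_neg_of_pos_of_neg h1 ((hup j).2 l hl)) (by positivity)).le
  have hlt : ((d l₁ : ℝ) - d l₀) * a j l₁ * z ^ (d l₁) < 0 := by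
    have h1 : 0 < (d l₁ : ℝ) - d l₀ := sub_pos.mpr (by exact_mod_cast hd l₁ hl₁)
    exact mul_neg_of_neg_of_pos (mul_neg_of_pos_of_neg h1 ((hup j).2 l₁ hl₁)) (by positivity)
  rw [← Finset.sum_erase_add _ _ (Finset.mem_univ l₁)]
  have := Finset.sum_nonpos hterm
  linarith

/-- ★★★ **THE MEAN-ORDERED SECTOR, EVERY `K`** (bottom coupling: `d l₀ < d l` for `l ≠ l₀`, some `l ≠ l₀`; every row upper-signed
against the coupled letter: `a_{j l₀} > 0`, `a_{jl} < 0` for `l ≠ l₀`).  If at every `x > 0`, for every SWITCHED row `j` (`f_j(x) < 0`)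
and every UNSWITCHED row `i` (`f_i(x) > 0`) the tilted gap-means are ordered, `B⁽²⁾_j(x)·B_i(x) ≤ B⁽²⁾_i(x)·B_j(x)` (both `B` are
negative, so this says `B⁽²⁾_j/B_j ≤ B⁽²⁾_i/B_i`: switched rows are at least as «low-gap heavy» as unswitched ones), then
`Z₊(eulerNumerator d a l₀) ≤ B + (B + 1)` for any bound `Z₊(∏ f_j) ≤ B`. [this file's theorem] -/
theorem sepWeight_meanOrdered_upperSigned {m K : ℕ} (d : Fin K → ℕ) (a : Fin m → Fin K → ℝ) (l₀ : Fin K)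
    (hd : ∀ l, l ≠ l₀ → d l₀ < d l) (hK : ∃ l : Fin K, l ≠ l₀)
    (hup : ∀ j, 0 < a j l₀ ∧ ∀ l, l ≠ l₀ → a j l < 0)
    (B : ℕ) (hZ : ((∏ j, ∑ l, C (a j l) * X ^ (d l) : ℝ[X]).roots.toFinset.filter (fun t => 0 < t)).card ≤ B)
    (hord : ∀ z : ℝ, 0 < z → ∀ j i, (∑ l, a j l * z ^ (d l)) < 0 → 0 < (∑ l, a i l * z ^ (d l)) → (∑ l, ((d l : ℝ) - d l₀) ^ 2 * a j l * z ^ (d l)) * (∑ l, ((d l : ℝ) - d l₀) * a i l * z ^ (d l)) ≤ (∑ l, ((d l : ℝ) - d l₀) ^ 2 * a i l * z ^ (d l)) * (∑ l, ((d l : ℝ) - d l₀) * a j l * z ^ (d l))) :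
    ((∑ j, (∑ l, C (a j l * ((d l : ℝ) - d l₀)) * X ^ (d l)) * ∏ i ∈ Finset.univ.erase j, (∑ l, C (a i l) * X ^ (d l)) : ℝ[X]).roots.toFinset.filter (fun t => 0 < t)).card ≤ B + (B + 1) := by
  classical
  have hBneg : ∀ j, ∀ z : ℝ, 0 < z → (∑ l, ((d l : ℝ) - d l₀) * a j l * z ^ (d l)) < 0 := fun j z hz => sepWeight_strippedRow_neg d a l₀ hd hK hup j hz
  have hP0 : (∏ j, ∑ l, C (a j l) * X ^ (d l) : ℝ[X]) ≠ 0 := by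
    rw [Finset.prod_ne_zero_iff]
    intro j _ h0
    have h : (X * derivative (∑ l, C (a j l) * X ^ (d l) : ℝ[X])).eval 1
        - (d l₀ : ℝ) * (∑ l, C (a j l) * X ^ (d l) : ℝ[X]).eval 1 = 0 := by
      rw [h0, derivative_zero, mul_zero, eval_zero, mul_zero, sub_zero]
    rw [sepWeight_eval_shiftedTheta] at h
    exact (hBneg j 1 one_pos).ne h
  refine sepWeight_meanPivot_eulerNumerator_le d a l₀ hP0 B hZ (fun z hz hg _hEz => ?_)
  -- the switched rows at `z`
  set S : Finset (Fin m) := Finset.univ.filter (fun j => (∑ l, a j l * z ^ (d l)) < 0) with hS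
  by_cases hSne : S.Nonempty
  · -- pivot = the LARGEST tilted mean among the switched rows
    obtain ⟨j₀, hj₀, hmax⟩ := S.exists_max_image (fun j => (∑ l, ((d l : ℝ) - d l₀) ^ 2 * a j l * z ^ (d l)) / (∑ l, ((d l : ℝ) - d l₀) * a j l * z ^ (d l))) hSne
    have hj₀' : (∑ l, a j₀ l * z ^ (d l)) < 0 := (Finset.mem_filter.mp hj₀).2
    have hB0 := hBneg j₀ z hz
    refine ⟨(∑ l, ((d l : ℝ) - d l₀) ^ 2 * a j₀ l * z ^ (d l)) / (∑ l, ((d l : ℝ) - d l₀) * a j₀ l * z ^ (d l)), fun j => ⟨?_, (hBneg j z hz).ne⟩⟩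
    have hBj := hBneg j z hz
    rcases lt_or_gt_of_ne (hg j) with hlt | hgt
    · -- switched row: its mean is `≤` the pivot, i.e. `μ·B_j ≤ B2_j`
      have hle : (∑ l, ((d l : ℝ) - d l₀) ^ 2 * a j l * z ^ (d l)) / (∑ l, ((d l : ℝ) - d l₀) * a j l * z ^ (d l)) ≤ (∑ l, ((d l : ℝ) - d l₀) ^ 2 * a j₀ l * z ^ (d l)) / (∑ l, ((d l : ℝ) - d l₀) * a j₀ l * z ^ (d l)) := hmax j (Finset.mem_filter.mpr ⟨Finset.mem_univ _, hlt⟩)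
      have h1 : (∑ l, ((d l : ℝ) - d l₀) ^ 2 * a j₀ l * z ^ (d l)) / (∑ l, ((d l : ℝ) - d l₀) * a j₀ l * z ^ (d l)) * (∑ l, ((d l : ℝ) - d l₀) * a j l * z ^ (d l)) ≤ (∑ l, ((d l : ℝ) - d l₀) ^ 2 * a j l * z ^ (d l)) := (div_le_iff_of_neg hBj).mp hle
      nlinarith
    · -- unswitched row: the order hypothesis against the switched row `j₀` gives `B2_j ≤ μ·B_j`
      have hle : (∑ l, ((d l : ℝ) - d l₀) ^ 2 * a j₀ l * z ^ (d l)) * (∑ l, ((d l : ℝ) - d l₀) * a j l * z ^ (d l)) ≤ (∑ l, ((d l : ℝ) - d l₀) ^ 2 * a j l * z ^ (d l)) * (∑ l, ((d l : ℝ) - d l₀) * a j₀ l * z ^ (d l)) := hord z hz j₀ j hj₀' hgt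
      have h1 : (∑ l, ((d l : ℝ) - d l₀) ^ 2 * a j l * z ^ (d l)) ≤ (∑ l, ((d l : ℝ) - d l₀) ^ 2 * a j₀ l * z ^ (d l)) / (∑ l, ((d l : ℝ) - d l₀) * a j₀ l * z ^ (d l)) * (∑ l, ((d l : ℝ) - d l₀) * a j l * z ^ (d l)) := by
        rw [div_mul_eq_mul_div, le_div_iff_of_neg hB0]
        linarith
      nlinarith
  · -- no switched row: pivot = the SMALLEST tilted mean
    rcases Nat.eq_zero_or_pos m with hm | hm
    · subst hm
      exact ⟨0, fun j => j.elim0⟩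
    obtain ⟨j₁, -, hmin⟩ := Finset.univ.exists_min_image (fun j => (∑ l, ((d l : ℝ) - d l₀) ^ 2 * a j l * z ^ (d l)) / (∑ l, ((d l : ℝ) - d l₀) * a j l * z ^ (d l))) ⟨⟨0, hm⟩, Finset.mem_univ _⟩
    refine ⟨(∑ l, ((d l : ℝ) - d l₀) ^ 2 * a j₁ l * z ^ (d l)) / (∑ l, ((d l : ℝ) - d l₀) * a j₁ l * z ^ (d l)), fun j => ⟨?_, (hBneg j z hz).ne⟩⟩
    have hBj := hBneg j z hz
    have hgt : 0 < (∑ l, a j l * z ^ (d l)) := by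
      rcases lt_or_gt_of_ne (hg j) with hlt | hgt
      · exact absurd ⟨j, Finset.mem_filter.mpr ⟨Finset.mem_univ _, hlt⟩⟩ hSne
      · exact hgt
    have hle : (∑ l, ((d l : ℝ) - d l₀) ^ 2 * a j₁ l * z ^ (d l)) / (∑ l, ((d l : ℝ) - d l₀) * a j₁ l * z ^ (d l)) ≤ (∑ l, ((d l : ℝ) - d l₀) ^ 2 * a j l * z ^ (d l)) / (∑ l, ((d l : ℝ) - d l₀) * a j l * z ^ (d l)) := hmin j (Finset.mem_univ _)
    have h1 : (∑ l, ((d l : ℝ) - d l₀) ^ 2 * a j l * z ^ (d l)) ≤ (∑ l, ((d l : ℝ) - d l₀) ^ 2 * a j₁ l * z ^ (d l)) / (∑ l, ((d l : ℝ) - d l₀) * a j₁ l * z ^ (d l)) * (∑ l, ((d l : ℝ) - d l₀) * a j l * z ^ (d l)) := (le_div_iff_of_neg hBj).mp hle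
    nlinarith

end ProductPlusOne

end Summit.ValiantsHypothesis.ValiantsHypothesis.Theorems.LacunarySymmetroidMatrixDescartes
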